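import Summits.ValiantsHypothesis.ValiantsHypothesis.Theorems.LacunarySymmetroidMatrixDescartesCensusDoorA34NoNinefold

/-!
# `MatrixDescartes` census — DOOR A at `(3,4)`: the SEMIDEFINITE CELL of the null-top sheet is HYPERBOLIC in the unfolding parameter —
# `det(G + s·S₃)` is real-rooted in `s` whenever the singular top letter `S₃` is semidefinite (Jacobi's complementary-minor identity)

HONEST FRAMING.  Object-search cell `pub-symmetroid`, engine seat `val-sym-eng-2` (g3; identity first offered by g2); helper row beside the registered strata line
`Cruxes/DoorA34/Lines/strata.lean` on stmt-ValiantsHypothesis-19980 (`DoorA34 = PosRootLawAt 3 4 18`: OPEN, typed, never asserted here), stub `stub_nullTopCeiling`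
(`det S₃ = 0 ⇒ ≤ 17`) OPEN on the generic sheet `tr(adj S₃·S₂) ≠ 0`.  That sheet has two inertia cells for the rank-two top letter: SEMIDEFINITE (`S₃ ≅ diag(a,b,0)`,
`ab > 0`) and INDEFINITE (`ab < 0`).  This seat's junction-parity law (DOOR-A34-ENG2G3-REPORT §4a) locates every hierarchical null-top seventeen of record in the
INDEFINITE cell; this file records the structural reason the SEMIDEFINITE cell is different: by the block identity
`det(G + s·S₃) = det G + s·tr(adj G·S₃) + s²·tr(adj S₃·G)` (`det S₃ = 0`), the unfolding parameter `s` enters QUADRATICALLY, and for `S₃ = diag(a,b,0)`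

* `jacobi_adjugate_minor` — `adj G₀₀ · adj G₁₁ − adj G₀₁ · adj G₁₀ = G₂₂ · det G` (the `2 × 2` minor of the adjugate is the complementary entry times `det`, any `3 × 3`);
* `trace_adjugate_mul_diag`, `trace_adjugate_diag_mul` — `tr(adj G · diag(a,b,0)) = a·adj G₀₀ + b·adj G₁₁`, `tr(adj diag(a,b,0) · G) = ab·G₂₂`;
* **`semidefSheet_discr_eq`** — `(a·adj G₀₀ + b·adj G₁₁)² − 4·(ab·G₂₂)·det G = (a·adj G₀₀ − b·adj G₁₁)² + 4ab·(adj G₀₁ · adj G₁₀)`, hence for SYMMETRIC `G` and `0 ≤ ab`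
  **`semidefSheet_discr_nonneg`**: the discriminant of `s ↦ det(G + s·diag(a,b,0))` is `≥ 0` — BOTH unfolding roots are REAL, at EVERY `t` when `G = G(t)` is the
  three-letter core of a null-top pencil (`semidefSheet_discr_nonneg_pencil`); consequently wherever `det G(t)` and the top window `ab·G(t)₂₂` have the same strict sign
  the middle window `tr(adj G(t)·S₃)` cannot vanish (`middleWindow_ne_zero_of_same_sign`) — a coupling of the three coefficient windows of
  `Census.det_pencil_nullTop_eq_blocks` that holds in the semidefinite cell only (in the indefinite cell `ab < 0` the discriminant is a DIFFERENCE of squares).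

Every semidefinite rank-two letter is congruent to `diag(a,b,0)`, and congruence `G ↦ PᵀGP` multiplies `det(G + sS₃)` by `det P²`, so the diagonal normal form is no loss.
Nothing here bounds `ζ_sym(3,4)`; no count on the semidefinite cell is proved (located: hierarchical designs reach 16 there, 17 in the indefinite cell); nothing on
`MatrixDescartes` (stmt-ValiantsHypothesis-18050) or `VP ≠ VNP` — VP≠VNP not moved.  [folklore] Jacobi's identity for the adjugate; `ring` / `nlinarith`.
-/

-- `Summit.ValiantsHypothesis.ValiantsHypothesis.…` repeats a component by the D-0017 layout
-- (single-conjunct summit), which the `dupNamespace` linter flags; the name is mandated.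
set_option linter.dupNamespace false

namespace Summit.ValiantsHypothesis.ValiantsHypothesis.Theorems.LacunarySymmetroidMatrixDescartes.Census.SemidefSheet

open scoped BigOperators Matrix
open Polynomial Finset

/-- **Jacobi's complementary-minor identity** for `3 × 3` matrices: the `{0,1}` principal minor of the adjugate is `G₂₂ · det G`. [folklore] -/
theorem jacobi_adjugate_minor (G : Matrix (Fin 3) (Fin 3) ℝ) :
    G.adjugate 0 0 * G.adjugate 1 1 - G.adjugate 0 1 * G.adjugate 1 0 = G 2 2 * G.det := by
  simp only [Matrix.adjugate_fin_three, Matrix.det_fin_three]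
  simp
  ring

/-- `tr(adj G · diag(a,b,0)) = a·adj G₀₀ + b·adj G₁₁`. [folklore] -/
theorem trace_adjugate_mul_diag (G : Matrix (Fin 3) (Fin 3) ℝ) (a b : ℝ) :
    (G.adjugate * Matrix.diagonal ![a, b, 0]).trace = a * G.adjugate 0 0 + b * G.adjugate 1 1 := by
  simp only [Matrix.trace_fin_three, Matrix.mul_apply, Fin.sum_univ_three, Matrix.diagonal_apply]
  simp
  ring

/-- `tr(adj diag(a,b,0) · G) = ab·G₂₂`. [folklore] -/
theorem trace_adjugate_diag_mul (G : Matrix (Fin 3) (Fin 3) ℝ) (a b : ℝ) :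
    ((Matrix.diagonal ![a, b, 0]).adjugate * G).trace = a * b * G 2 2 := by
  simp only [Matrix.adjugate_fin_three, Matrix.trace_fin_three, Matrix.mul_apply, Fin.sum_univ_three, Matrix.diagonal_apply]
  simp

/-- `det(G + s·diag(a,b,0)) = det G + s·tr(adj G·diag(a,b,0)) + s²·ab·G₂₂` — the unfolding parameter enters quadratically. [folklore] -/
theorem det_add_smul_diag (G : Matrix (Fin 3) (Fin 3) ℝ) (a b s : ℝ) :
    (G + s • Matrix.diagonal ![a, b, 0]).det = G.det + (a * G.adjugate 0 0 + b * G.adjugate 1 1) * s + a * b * G 2 2 * s ^ 2 := by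
  simp only [Matrix.det_fin_three, Matrix.adjugate_fin_three, Matrix.add_apply, Matrix.smul_apply, Matrix.diagonal_apply, smul_eq_mul]
  simp
  ring

/-- **The discriminant identity of the semidefinite sheet**: `(a·adj G₀₀ + b·adj G₁₁)² − 4(ab·G₂₂)·det G = (a·adj G₀₀ − b·adj G₁₁)² + 4ab·(adj G₀₁·adj G₁₀)`
(Jacobi). [folklore] -/
theorem semidefSheet_discr_eq (G : Matrix (Fin 3) (Fin 3) ℝ) (a b : ℝ) :
    (a * G.adjugate 0 0 + b * G.adjugate 1 1) ^ 2 - 4 * (a * b * G 2 2) * G.det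
      = (a * G.adjugate 0 0 - b * G.adjugate 1 1) ^ 2 + 4 * (a * b) * (G.adjugate 0 1 * G.adjugate 1 0) := by
  have h := jacobi_adjugate_minor G
  linear_combination (4 * (a * b)) * h

/-- For a SYMMETRIC matrix the adjugate is symmetric: `adj G₀₁ = adj G₁₀`. [folklore] -/
theorem adjugate_01_eq_10_of_isSymm (G : Matrix (Fin 3) (Fin 3) ℝ) (hG : G.IsSymm) : G.adjugate 0 1 = G.adjugate 1 0 := by
  have h10 : G 1 0 = G 0 1 := by
    have h := congrFun (congrFun hG 1) 0
    simp [Matrix.transpose_apply] at h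
    exact h.symm
  have h20 : G 2 0 = G 0 2 := by
    have h := congrFun (congrFun hG 2) 0
    simp [Matrix.transpose_apply] at h
    exact h.symm
  have h21 : G 2 1 = G 1 2 := by
    have h := congrFun (congrFun hG 2) 1
    simp [Matrix.transpose_apply] at h
    exact h.symm
  simp only [Matrix.adjugate_fin_three]
  simp [h10, h20, h21]
  ring

/-- **SEMIDEFINITE CELL ⇒ REAL UNFOLDING ROOTS.**  For a real symmetric `3 × 3` matrix `G` and `0 ≤ ab`, the quadratic `s ↦ det(G + s·diag(a,b,0))` has
non-negative discriminant. [folklore] -/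
theorem semidefSheet_discr_nonneg (G : Matrix (Fin 3) (Fin 3) ℝ) (hG : G.IsSymm) (a b : ℝ) (hab : 0 ≤ a * b) :
    0 ≤ (a * G.adjugate 0 0 + b * G.adjugate 1 1) ^ 2 - 4 * (a * b * G 2 2) * G.det := by
  rw [semidefSheet_discr_eq, adjugate_01_eq_10_of_isSymm G hG]
  have h1 : 0 ≤ (a * G.adjugate 0 0 - b * G.adjugate 1 1) ^ 2 := sq_nonneg _
  have h2 : 0 ≤ G.adjugate 1 0 * G.adjugate 1 0 := mul_self_nonneg _
  nlinarith

/-- **Window coupling in the semidefinite cell**: where `det G` and the top window `ab·G₂₂` have the same strict sign, the middle window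
`tr(adj G·diag(a,b,0))` does not vanish. [folklore] -/
theorem middleWindow_ne_zero_of_same_sign (G : Matrix (Fin 3) (Fin 3) ℝ) (hG : G.IsSymm) (a b : ℝ) (hab : 0 ≤ a * b)
    (hsame : 0 < (a * b * G 2 2) * G.det) :
    (G.adjugate * Matrix.diagonal ![a, b, 0]).trace ≠ 0 := by
  rw [trace_adjugate_mul_diag]
  intro h0
  have h := semidefSheet_discr_nonneg G hG a b hab
  rw [h0] at h
  nlinarith

/-- **Pencil form.**  For real symmetric letters `S₀, S₁, S₂`, any exponents, and any `t`: the three-letter core `G(t) = Σ_l t^{d l} S_l` satisfies the semidefinite-sheet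
discriminant inequality — the two unfolding roots `s` of `det(G(t) + s·diag(a,b,0))` are real for `0 ≤ ab`. [folklore] -/
theorem semidefSheet_discr_nonneg_pencil (d : Fin 3 → ℕ) (S : Fin 3 → Matrix (Fin 3) (Fin 3) ℝ) (hS : ∀ l, (S l).IsSymm) (a b : ℝ) (hab : 0 ≤ a * b) (t : ℝ) :
    0 ≤ (a * (∑ l, t ^ d l • S l).adjugate 0 0 + b * (∑ l, t ^ d l • S l).adjugate 1 1) ^ 2
        - 4 * (a * b * (∑ l, t ^ d l • S l) 2 2) * (∑ l, t ^ d l • S l).det := by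
  refine semidefSheet_discr_nonneg _ ?_ a b hab
  unfold Matrix.IsSymm
  rw [Matrix.transpose_sum]
  refine Finset.sum_congr rfl fun l _ => ?_
  rw [Matrix.transpose_smul, (hS l)]

end Summit.ValiantsHypothesis.ValiantsHypothesis.Theorems.LacunarySymmetroidMatrixDescartes.Census.SemidefSheet
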